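import Summits.ValiantsHypothesis.ValiantsHypothesis.Theorems.BarrierLeverPartitionMinorsHitByVPBrickCalculus

/-!
# Route BarrierLever — item `PartitionMinorsHitByVP` (stmt-ValiantsHypothesis-19717):
# the VERTEX-SPLIT step with DEFECT TRANSFER (door-independent template)

Helper file (`--supports stmt-ValiantsHypothesis-19717`; cell valiant-natproofs, rung V4, 𝒟-side door (c);
prover seat val-np-p1 gen 14). Definition-free. Closes NO item.

The general form of the step behind `…CubeBall` (seat memo HOME/val-np-p1/g14/ANCHORED-MEMO-valnp1-g14.md §6.2). Fix an
`x`-vertex `a`, a `y`-vertex `c`, a polynomial `f₀` free of `x_a` and `y_c` and a polynomial `q` free of `x_a` and `y_c`,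
and put `f := f₀ · (1 + x_a (y_c + q))`. On a layout `(u, w)` the rows of `f` are (`coeff_splitWitness`):
```
  a ∉ u i :  f[u i, w j] = [c ∉ w j] · f₀[u i, w j]
  a ∈ u i :  f[u i, w j] = [c ∈ w j] · f₀[u i − a, w j − c] + [c ∉ w j] · (q f₀)[u i − a, w j]
```
(in the zeon algebra: the rows `ρ⁰_S` of `f₀` and the rows `(y_c + q) ρ⁰_{S'}` of the peeled link). Hence
(`det_splitWitness_ne_zero`) the layout matrix of `f` is nonsingular as soon as
 (i) the `f₀`-rows `u i ∌ a` are linearly independent on the columns `w j ∌ c`, and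
 (ii) DEFECT TRANSFER: whenever a combination `B = Σ β_i ρ⁰_{u i − a}` of link rows vanishes on the columns `w j − c`
     (`c ∈ w j`) and `q·B` lies, on the columns `w j ∌ c`, in the span of the rows of (i), then `β = 0`.
When `#{i : a ∈ u i} = #{j : c ∈ w j}` condition (ii) is just «the link rows span», and the step is the single-star peel;
otherwise (ii) is a Lefschetz-type statement (in `…CubeBall`: hard Lefschetz for a Boolean lattice). No lower-set or
injectivity hypothesis is needed for this direction.

WHAT THIS IS NOT: conditions (i)/(ii) are hypotheses; nothing is claimed about when they hold beyond `…CubeBall`; nothing on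
crux stmt-ValiantsHypothesis-14610 or `VP` versus `VNP`.
-/

set_option linter.dupNamespace false

namespace Summit.ValiantsHypothesis.ValiantsHypothesis.Theorems.BarrierLever.SplitStep

open Finset MvPolynomial
open Summit.ValiantsHypothesis.ValiantsHypothesis.Theorems.BarrierLever.BrickCalculus
open Summit.ValiantsHypothesis.ValiantsHypothesis.Theorems.BarrierLever.ProductStateSums (castAdd_ne_natAdd)

noncomputable section

variable {h : ℕ}

/-- Rows of `F · x_a`: `coeff_{x^U y^W} (F x_a) = [a ∈ U] coeff_{x^{U−a} y^W} F`. -/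
theorem coeff_pexpo_mul_X_castAdd (F : MvPolynomial (Fin (h + h)) ℂ) (a : Fin h) (U W : Finset (Fin h)) :
    coeff (pexpo U W) (F * X (Fin.castAdd h a)) =
      if a ∈ U then coeff (pexpo (U.erase a) W) F else 0 := by
  classical
  have hb : (X (Fin.castAdd h a) : MvPolynomial (Fin (h + h)) ℂ) = brick {a} ∅ - 1 := by
    rw [brick_eq, pexpo]; simp [X]
  rw [hb, mul_sub, mul_one, coeff_sub, coeff_pexpo_mul_brick, add_sub_cancel_left]
  by_cases ha : a ∈ U
  · rw [if_pos ⟨Finset.singleton_subset_iff.mpr ha, Finset.empty_subset _⟩, if_pos ha,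
      Finset.sdiff_singleton_eq_erase, Finset.sdiff_empty]
  · rw [if_neg (fun hc => ha (Finset.singleton_subset_iff.mp hc.1)), if_neg ha]

/-- Rows of `F · x_a y_c`: `coeff_{x^U y^W} (F x_a y_c) = [a ∈ U][c ∈ W] coeff_{x^{U−a} y^{W−c}} F`. -/
theorem coeff_pexpo_mul_X_castAdd_mul_X_natAdd (F : MvPolynomial (Fin (h + h)) ℂ) (a c : Fin h)
    (U W : Finset (Fin h)) :
    coeff (pexpo U W) (F * (X (Fin.castAdd h a) * X (Fin.natAdd h c))) =
      if a ∈ U ∧ c ∈ W then coeff (pexpo (U.erase a) (W.erase c)) F else 0 := by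
  classical
  have hb : (X (Fin.castAdd h a) * X (Fin.natAdd h c) : MvPolynomial (Fin (h + h)) ℂ) = brick {a} {c} - 1 := by
    rw [brick_eq, pexpo]; simp [X, monomial_mul]
  rw [hb, mul_sub, mul_one, coeff_sub, coeff_pexpo_mul_brick, add_sub_cancel_left]
  by_cases hac : a ∈ U ∧ c ∈ W
  · rw [if_pos ⟨Finset.singleton_subset_iff.mpr hac.1, Finset.singleton_subset_iff.mpr hac.2⟩, if_pos hac,
      Finset.sdiff_singleton_eq_erase, Finset.sdiff_singleton_eq_erase]
  · rw [if_neg (fun hc => hac ⟨Finset.singleton_subset_iff.mp hc.1, Finset.singleton_subset_iff.mp hc.2⟩), if_neg hac]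

/-- **Rows of the split witness** `f = f₀ (1 + x_a (y_c + q))` with `f₀`, `q` free of `x_a` and `y_c`
(given as variable-support hypotheses through `A ∌ a`, `B ∌ c`). -/
theorem coeff_splitWitness (f₀ q : MvPolynomial (Fin (h + h)) ℂ) (a c : Fin h) (A B : Finset (Fin h))
    (ha : a ∉ A) (hc : c ∉ B)
    (hf₀ : f₀.vars ⊆ A.image (Fin.castAdd h) ∪ B.image (Fin.natAdd h))
    (hq : (q * f₀).vars ⊆ A.image (Fin.castAdd h) ∪ B.image (Fin.natAdd h)) (U W : Finset (Fin h)) :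
    coeff (pexpo U W) (f₀ * (1 + X (Fin.castAdd h a) * (X (Fin.natAdd h c) + q))) =
      (if a ∈ U then 0 else if c ∈ W then 0 else coeff (pexpo U W) f₀) +
      (if a ∈ U then
        ((if c ∈ W then coeff (pexpo (U.erase a) (W.erase c)) f₀ else 0) +
         (if c ∈ W then 0 else coeff (pexpo (U.erase a) W) (q * f₀))) else 0) := by
  classical
  have hsplit : f₀ * (1 + X (Fin.castAdd h a) * (X (Fin.natAdd h c) + q)) =
      f₀ + f₀ * (X (Fin.castAdd h a) * X (Fin.natAdd h c)) + (q * f₀) * X (Fin.castAdd h a) := by ring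
  rw [hsplit, coeff_add, coeff_add, coeff_pexpo_mul_X_castAdd_mul_X_natAdd, coeff_pexpo_mul_X_castAdd]
  have h0 : ∀ U' W' : Finset (Fin h), a ∈ U' → coeff (pexpo U' W') f₀ = 0 := fun U' W' haU =>
    coeff_pexpo_eq_zero_of_vars f₀ A B hf₀ U' W' (fun hc' => ha (hc'.1 haU))
  have h0c : ∀ U' W' : Finset (Fin h), c ∈ W' → coeff (pexpo U' W') f₀ = 0 := fun U' W' hcW =>
    coeff_pexpo_eq_zero_of_vars f₀ A B hf₀ U' W' (fun hc' => hc (hc'.2 hcW))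
  have hq0 : ∀ U' W' : Finset (Fin h), c ∈ W' → coeff (pexpo U' W') (q * f₀) = 0 := fun U' W' hcW =>
    coeff_pexpo_eq_zero_of_vars _ A B hq U' W' (fun hc' => hc (hc'.2 hcW))
  by_cases haU : a ∈ U
  · by_cases hcW : c ∈ W
    · simp [haU, hcW, h0 U W haU, hq0 (U.erase a) W hcW]
    · simp [haU, hcW, h0 U W haU]
  · by_cases hcW : c ∈ W
    · simp [haU, hcW, h0c U W hcW]
    · simp [haU, hcW]

/-- **The split step with defect transfer.** Let `f = f₀ (1 + x_a (y_c + q))` with `f₀`, `q f₀` supported on variables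
avoiding `x_a`, `y_c`. If (i) the `f₀`-rows of the layout rows NOT containing `a` are linearly independent on the columns
NOT containing `c`, and (ii) every combination `β` of the link rows `u i − a` (`a ∈ u i`) whose `f₀`-rows vanish on the
link columns `w j − c` (`c ∈ w j`) and whose `q f₀`-rows lie, on the columns `w j ∌ c`, in the span of the rows of (i),
is zero — then the layout matrix of `f` is nonsingular. -/
theorem det_splitWitness_ne_zero {r : ℕ} (u w : Fin r → Finset (Fin h)) (f₀ q : MvPolynomial (Fin (h + h)) ℂ)
    (a c : Fin h) (A B : Finset (Fin h)) (ha : a ∉ A) (hc : c ∉ B)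
    (hf₀ : f₀.vars ⊆ A.image (Fin.castAdd h) ∪ B.image (Fin.natAdd h))
    (hq : (q * f₀).vars ⊆ A.image (Fin.castAdd h) ∪ B.image (Fin.natAdd h))
    (hi : ∀ α : Fin r → ℂ, (∀ i, a ∈ u i → α i = 0) →
      (∀ j, c ∉ w j → ∑ i, α i * coeff (pexpo (u i) (w j)) f₀ = 0) → α = 0)
    (hii : ∀ α β : Fin r → ℂ, (∀ i, a ∈ u i → α i = 0) → (∀ i, a ∉ u i → β i = 0) →
      (∀ j, c ∈ w j → ∑ i, β i * coeff (pexpo ((u i).erase a) ((w j).erase c)) f₀ = 0) →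
      (∀ j, c ∉ w j → ∑ i, α i * coeff (pexpo (u i) (w j)) f₀ +
        ∑ i, β i * coeff (pexpo ((u i).erase a) (w j)) (q * f₀) = 0) → β = 0) :
    (Matrix.of fun i j : Fin r => coeff (pexpo (u i) (w j))
      (f₀ * (1 + X (Fin.castAdd h a) * (X (Fin.natAdd h c) + q)))).det ≠ 0 := by
  classical
  intro hdet
  obtain ⟨v, hv, hvM⟩ := Matrix.exists_vecMul_eq_zero_iff.mpr hdet
  -- split the dependency into the deletion part `α` and the link part `β`
  let α : Fin r → ℂ := fun i => if a ∈ u i then 0 else v i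
  let β : Fin r → ℂ := fun i => if a ∈ u i then v i else 0
  have hcol : ∀ j, ∑ i, v i * coeff (pexpo (u i) (w j))
      (f₀ * (1 + X (Fin.castAdd h a) * (X (Fin.natAdd h c) + q))) = 0 := fun j => by
    have := congrFun hvM j
    rw [Matrix.vecMul, dotProduct] at this
    simpa only [Matrix.of_apply, Pi.zero_apply] using this
  have hC1 : ∀ j, c ∈ w j → ∑ i, β i * coeff (pexpo ((u i).erase a) ((w j).erase c)) f₀ = 0 := by
    intro j hcj
    have h1 := hcol j
    rw [← h1]
    refine Finset.sum_congr rfl (fun i _ => ?_)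
    rw [coeff_splitWitness f₀ q a c A B ha hc hf₀ hq]
    by_cases hai : a ∈ u i <;> simp [β, hai, hcj]
  have hC0 : ∀ j, c ∉ w j → ∑ i, α i * coeff (pexpo (u i) (w j)) f₀ +
      ∑ i, β i * coeff (pexpo ((u i).erase a) (w j)) (q * f₀) = 0 := by
    intro j hcj
    have h1 := hcol j
    rw [← h1, ← Finset.sum_add_distrib]
    refine Finset.sum_congr rfl (fun i _ => ?_)
    rw [coeff_splitWitness f₀ q a c A B ha hc hf₀ hq]
    by_cases hai : a ∈ u i <;> simp [α, β, hai, hcj]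
  have hβ : β = 0 := hii α β (fun i hai => by simp [α, hai]) (fun i hai => by simp [β, hai]) hC1 hC0
  have hα : α = 0 := by
    refine hi α (fun i hai => by simp [α, hai]) (fun j hcj => ?_)
    have := hC0 j hcj
    rw [hβ] at this
    simpa using this
  apply hv
  funext i
  by_cases hai : a ∈ u i
  · have := congrFun hβ i; simp [β, hai] at this; exact this
  · have := congrFun hα i; simp [α, hai] at this; exact this

end

end Summit.ValiantsHypothesis.ValiantsHypothesis.Theorems.BarrierLever.SplitStep
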